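import Literature.MathematicalPhysics.QuantumLattice.SectorisedIncrementBoundBinomialWeightedPrescribedPlateau
import Literature.MathematicalPhysics.QuantumLattice.GrassmannWeightedGaussConvBinomialGramPrescribedSubLaplacian
import Literature.MathematicalPhysics.QuantumLattice.GrassmannChargeScaling
import Literature.MathematicalPhysics.QuantumLattice.GrassmannLinearSubstitution
import HarnessLib

/-!
# The FIRST ORDER of the sectorised single-scale increment MINUS ITS ONE-LINE TERM (`e^{Δ_C}G − G − Δ_C G`), binomial–Gram form, PRESCRIBED output legs,
# DECAY-WEIGHTED, plateau transport

Topic `MathematicalPhysics/QuantumLattice`; companion of `SectorisedIncrementBoundBinomialWeightedPrescribedPlateau` (Benfatto–Giuliani–Mastropietro 2006 (2.61)–(2.63),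
(2.66) at first order, (2.86)–(2.90), §2.8 (2.82)–(2.84), (2.88)–(2.90), App. A3 Lemma A3.1; §3 (3.2)–(3.8)).  In the three-piece split of one Gaussian step
`(Δ_C G) + (e^{Δ_C}G − G − Δ_C G) + (effAction C G − e^{Δ_C}G)` (one line · at least two self-lines · at least two vertices) the FIRST piece is the tadpole-type
self-contraction (for a two-leg output it is fed by the quartic kernel of `G` only, linear in it — its local part is exactly local); this file bounds the SECOND
piece exactly as the companion bounds `e^{Δ_C}G − G`: the same prescribed weighted binomial–Gram sum over the input degrees `2m′ ≥ 2(q+1) + 4` only (`m′ > q + 2`),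
read through `(f, g)` and transported to the Hubbard torus by the plateau machinery (the one-line term does not see the plateau rescaling:
`map_sectorAnalysis_grassmannLaplacian_map_sectorPreimage_of_plateau`, by `grassmannLaplacian_map_mulLeft`).  The abstract supplier is
`GrassmannWeightedGaussConvBinomialGramPrescribedSubLaplacian.sum_wt_norm_kernel_gaussConv_sub_sub_laplacian_le_binomial_prescribed_of_gramBounded`.

* §2a **`map_sectorAnalysis_grassmannLaplacian_map_sectorPreimage_of_plateau`**;
* §2 **`sum_filter_wt_norm_kernel_map_gaussConv_sub_sub_laplacian_le_binomial_prescribed_of_gramBounded`** (generic labels, read through `(f, g)`);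
* §3 **`sum_filter_wt_norm_sectorAnalysis_gaussConv_sub_sub_laplacian_le_binomial_prescribed_of_plateau`** (Hubbard torus, plateau transfer; the input hypothesis
  is the companion's `sum_wt_norm_kernel_sectorPreimage_parentSlots_le_of_wt_prescribedSum_le`, reused).

Use (cell gate-hubbard-kl, K3 engine child, E1 interface (E2) in-tower route / located risk #17): the two-leg born sizes of a tower increment WITHOUT the block
tadpole, whose pure moments feed the two-leg symbol data; the companion's bound re-admits the tadpole mass.  Everything is proved; no definition, no named fact.

## Sources

G. Benfatto, A. Giuliani, V. Mastropietro, Ann. Henri Poincaré 7 (2006) 809–898, (2.61)–(2.63), (2.66), (2.70)–(2.71a), (2.86)–(2.90), §2.8 (2.76)–(2.84),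
App. A3 Lemma A3.1, §3 (3.2)–(3.8) [`BenfattoGiulianiMastropietro2006`]; M. Salmhofer, *Renormalization* (1999), §4.3 (4.86)–(4.95), App. B.2 (B.23)–(B.25) [`Salmhofer1999`].
-/

noncomputable section

namespace Literature.MathematicalPhysics.QuantumLattice

open GrassmannAlgebra Finset Literature.Probability.LatticeModels Literature.Probability.LatticeModels.BattleFederbush
open scoped Nat

universe u

/-! ### §2a The one-line term and the plateau rescaling -/

section LaplacianPlateau

variable {L M : ℕ} [NeZero L] [NeZero M] {N N' : ℕ}

/-- **The `F′`-measurement of `Δ_C G` does not see the plateau rescaling**: if `Σ_ω F_ω = 1` on the momenta of `supp C` and of `supp F′` then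
`map (toLin' E(F′)) (Δ_C (map (toLin' S(F̃)) Ṽ)) = map (toLin' E(F′)) (Δ_C G)` — the one-line twin of
`map_sectorAnalysis_gaussConv_map_sectorPreimage_of_plateau` (`grassmannLaplacian_map_mulLeft` in place of `gaussConv_map_mulLeft`).
[cite: BenfattoGiulianiMastropietro2006, §2.7 (2.70)–(2.71)] -/
theorem map_sectorAnalysis_grassmannLaplacian_map_sectorPreimage_of_plateau {β : ℝ} (hβ : β ≠ 0)
    (F Ft : Fin N → FreqMomentum L M → ℂ) (hFF : ∀ ω k, Ft ω k * F ω k = F ω k)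
    (hF0 : ∀ k, ∑ ω, F ω k = 0 → ∀ ω, F ω k = 0) (F' : Fin N' → FreqMomentum L M → ℂ) (G : HubbardGrassmann L M)
    (C : Matrix (HubbardFieldIdx L M) (HubbardFieldIdx L M) ℂ)
    (hCpl : ∀ X Y, C X Y ≠ 0 → ∑ ω, F ω X.1.1 = 1 ∧ ∑ ω, F ω Y.1.1 = 1)
    (hF'pl : ∀ (ω' : Fin N') (k : FreqMomentum L M), F' ω' k ≠ 0 → ∑ ω, F ω k = 1) :
    ExteriorAlgebra.map (Matrix.toLin' (sectorAnalysisMatrix L M β F'))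
        (grassmannLaplacian ℂ C (ExteriorAlgebra.map (Matrix.toLin' (sectorSubMatrix L M β Ft)) (sectorPreimage β F G))) =
      ExteriorAlgebra.map (Matrix.toLin' (sectorAnalysisMatrix L M β F')) (grassmannLaplacian ℂ C G) := by
  set Rf : HubbardFieldIdx L M → ℂ := fun K => ∑ ω, F ω K.1.1 with hRf
  have hcov : ∀ X Y, Rf X * Rf Y * C X Y = C X Y := by
    intro X Y
    by_cases h0 : C X Y = 0
    · rw [h0, mul_zero]
    · obtain ⟨h1, h2⟩ := hCpl X Y h0
      rw [show Rf X = 1 from h1, show Rf Y = 1 from h2, one_mul, one_mul]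
  have hCe : (Matrix.of fun X Y => Rf X * Rf Y * C X Y) = C := Matrix.ext fun X Y => hcov X Y
  have hcomp : Matrix.toLin' (sectorAnalysisMatrix L M β F') ∘ₗ LinearMap.mulLeft ℂ Rf =
      Matrix.toLin' (sectorAnalysisMatrix L M β F') :=
    toLin'_sectorAnalysis_comp_mulLeft β F' Rf fun ω' K hK => hF'pl ω' K.1.1 hK
  rw [map_sectorSub_sectorPreimage_eq_map_mulLeft hβ F Ft hFF hF0 G, grassmannLaplacian_map_mulLeft, hCe, map_map_eq_map_comp, hcomp]

end LaplacianPlateau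

/-! ### §2 Generic label sets: the weighted prescribed first order MINUS ITS ONE-LINE TERM read through `(f, g)` -/

section Generic

variable {𝕜 : Type*} [RCLike 𝕜] {Γ Γ' Γ'' : Type u} {Λ : Type*} [Fintype Γ] [DecidableEq Γ] [Fintype Γ'] [DecidableEq Γ']
  [Fintype Γ''] [DecidableEq Γ''] [DecidableEq Λ] {wt : Finset Λ → ℝ}

/-- **First order of the increment MINUS ITS ONE-LINE TERM, PRESCRIBED output legs, WEIGHTED output positions, read through `(f, g)`, binomial–Gram form** (BGM 2006 (2.61)–(2.63), (2.66) at
first order with (2.70)–(2.71a), (2.88)–(2.90), §3 (3.2)–(3.8)): `Ṽ` even on the auxiliary labels `Γ′`, `C′ = fᵀ C f` replica-Gram-bounded (`κ ≥ 0`); output degree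
`2(q+1)`, leg `i ∉ J` pinned at `w″`, legs `j ∈ J` constrained to `P j`, predicates `A j` on `Γ′` inherited through the matrix of `g ∘ f`; the input through its
`A`-constrained WEIGHTED anchored norms `N(m′, F)`; weighted analysis costs `(cr, cc)`.  Then
`Σ_{X″_i = w″, P j (X″_j)} wt(π″X″)·‖kernel_{2(q+1)}(map g (e^{Δ_C}(map f Ṽ) − map f Ṽ − Δ_C(map f Ṽ)))(X″)‖ ≤ cr·cc^{2q+1}·Σ_{m′ > q+2} (2q+2)!⁻¹(∏_{j∉J}(2m′−j))(2m′)^{|J|}κ^{2m′−2q−2} N(m′, |J|)`.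
[cite: BenfattoGiulianiMastropietro2006, (2.61)-(2.63), (2.66), (2.88)-(2.90), (3.2)-(3.8)] -/
theorem sum_filter_wt_norm_kernel_map_gaussConv_sub_sub_laplacian_le_binomial_prescribed_of_gramBounded
    (hwt : IsTreeWeight wt) (π' : Γ' → Λ) (π'' : Γ'' → Λ)
    (C : Matrix Γ Γ 𝕜) (f : (Γ' → 𝕜) →ₗ[𝕜] (Γ → 𝕜)) (g : (Γ → 𝕜) →ₗ[𝕜] (Γ'' → 𝕜))
    (Vt : GrassmannAlgebra 𝕜 Γ') (hVt : Vt ∈ evenPart 𝕜 Γ')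
    {κ : ℝ} (hκ : 0 ≤ κ) (hGB : IsGramBoundedR ((LinearMap.toMatrix' f).transpose * C * LinearMap.toMatrix' f) κ)
    {q : ℕ} (i : Fin (2 * q + 1 + 1)) (J : Finset (Fin (2 * q + 1 + 1))) (hi : i ∉ J) (P : Fin (2 * q + 1 + 1) → Γ'' → Prop)
    [∀ j, DecidablePred (P j)] (A : Fin (2 * q + 1 + 1) → Γ' → Bool)
    (hPA : ∀ j ∈ J, ∀ (y'' : Γ'') (x' : Γ'), P j y'' → (LinearMap.toMatrix' g * LinearMap.toMatrix' f) y'' x' ≠ 0 → A j x' = true)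
    (N : ℕ → ℕ → ℝ) (hN0 : ∀ m' F, 0 ≤ N m' F)
    (hN : ∀ (m' : ℕ) (T : Finset (Fin (2 * q + 1 + 1))), T ⊆ J → ∀ (ι : T → Fin (2 * m')), Function.Injective ι →
      ∀ (t : Fin (2 * m')), (∀ j, ι j ≠ t) → ∀ a : Γ',
        ∑ Y ∈ univ.filter (fun Y : Fin (2 * m') → Γ' => Y t = a),
          ‖kernel 𝕜 Vt (2 * m') Y‖ * wt ((univ.image Y).image π') * ∏ j : T, (if A j (Y (ι j)) = true then (1 : ℝ) else 0) ≤ N m' T.card)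
    {cr cc : ℝ} (hcc0 : 0 ≤ cc)
    (hrow' : ∀ X'', ∑ X', ‖(LinearMap.toMatrix' g * LinearMap.toMatrix' f) X'' X'‖ * wt {π'' X'', π' X'} ≤ cr)
    (hcol' : ∀ X', ∑ X'', ‖(LinearMap.toMatrix' g * LinearMap.toMatrix' f) X'' X'‖ * wt {π'' X'', π' X'} ≤ cc) (w'' : Γ'') :
    ∑ X'' ∈ univ.filter (fun X'' : Fin (2 * q + 1 + 1) → Γ'' => X'' i = w'' ∧ ∀ j ∈ J, P j (X'' j)), wt ((univ.image X'').image π'') *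
        ‖kernel 𝕜 (ExteriorAlgebra.map g (gaussConv 𝕜 C (ExteriorAlgebra.map f Vt) - ExteriorAlgebra.map f Vt -
          grassmannLaplacian 𝕜 C (ExteriorAlgebra.map f Vt))) (2 * q + 1 + 1) X''‖ ≤
      cr * cc ^ (2 * q + 1) *
        ∑ m' ∈ range (Fintype.card Γ' / 2 + 1), (if q + 1 + 1 < m' then
          ((((2 * (q + 1)).factorial : ℝ))⁻¹ * ((∏ j ∈ univ.filter (fun j : Fin (2 * (q + 1)) => j ∉ J), (2 * m' - (j : ℕ)) : ℕ) : ℝ)) *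
            ((2 * m' : ℕ) : ℝ) ^ J.card * κ ^ (2 * m' - 2 * (q + 1)) * N m' J.card else 0) := by
  set C' : Matrix Γ' Γ' 𝕜 := (LinearMap.toMatrix' f).transpose * C * LinearMap.toMatrix' f with hC'
  -- the weight pulled back to the auxiliary labels is a tree weight
  set wt' : Finset Γ' → ℝ := fun S => wt (S.image π') with hwt'
  have hwt'tree : IsTreeWeight wt' := hwt.comap π'
  set Bsum : ℝ := ∑ m' ∈ range (Fintype.card Γ' / 2 + 1), (if q + 1 + 1 < m' then
      ((((2 * (q + 1)).factorial : ℝ))⁻¹ * ((∏ j ∈ univ.filter (fun j : Fin (2 * (q + 1)) => j ∉ J), (2 * m' - (j : ℕ)) : ℕ) : ℝ)) *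
        ((2 * m' : ℕ) : ℝ) ^ J.card * κ ^ (2 * m' - 2 * (q + 1)) * N m' J.card else 0) with hBsum
  have hB0 : 0 ≤ Bsum := sum_nonneg fun m' _ => by
    split_ifs
    · exact mul_nonneg (mul_nonneg (mul_nonneg (mul_nonneg (inv_nonneg.2 (Nat.cast_nonneg _)) (Nat.cast_nonneg _))
        (pow_nonneg (Nat.cast_nonneg _) _)) (pow_nonneg hκ _)) (hN0 _ _)
    · exact le_rfl
  -- the abstract weighted prescribed first order in the auxiliary representation, for every pin (degree `2(q+1) = (2q+1)+1`)
  have hK : ∀ a : Γ', ∑ W ∈ univ.filter (fun W : Fin (2 * q + 1 + 1) → Γ' => W i = a ∧ ∀ j ∈ J, A j (W j) = true),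
      ‖kernel 𝕜 (gaussConv 𝕜 C' Vt - Vt - grassmannLaplacian 𝕜 C' Vt) (2 * q + 1 + 1) W‖ * wt ((univ.image W).image π') ≤ Bsum := fun a =>
    le_of_eq_of_le (sum_congr rfl fun W _ => mul_comm _ _)
      (sum_wt_norm_kernel_gaussConv_sub_sub_laplacian_le_binomial_prescribed_of_gramBounded (C := C') hwt'tree hκ hGB Vt hVt (p := q + 1) J A N
        hN0 hN i hi a)
  -- read through `g ∘ f`
  have hsub : gaussConv 𝕜 C (ExteriorAlgebra.map f Vt) - ExteriorAlgebra.map f Vt - grassmannLaplacian 𝕜 C (ExteriorAlgebra.map f Vt) =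
      ExteriorAlgebra.map f (gaussConv 𝕜 C' Vt - Vt - grassmannLaplacian 𝕜 C' Vt) := by
    rw [gaussConv_map, grassmannLaplacian_map, map_sub, map_sub]
  rw [hsub, map_map_eq_map_comp]
  exact sum_filter_wt_norm_kernel_map_prescribed_le hwt π' π'' (g ∘ₗ f) hcc0
    (by intro X''; rw [LinearMap.toMatrix'_comp]; exact hrow' X'')
    (by intro X'; simp only [LinearMap.toMatrix'_comp]; exact hcol' X') (gaussConv 𝕜 C' Vt - Vt - grassmannLaplacian 𝕜 C' Vt) (2 * q + 1) i J P A
    (by intro j hj y'' x' hPj hne; rw [LinearMap.toMatrix'_comp] at hne; exact hPA j hj y'' x' hPj hne) hB0 hK w''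

end Generic

/-! ### §3 The Hubbard torus: plateau transfer (the one-line term does not see the plateau rescaling either) -/

section Transfer

variable {L M : ℕ} [NeZero L] [NeZero M] {N N' : ℕ} {Λ : Type*} [DecidableEq Λ] {wt : Finset Λ → ℝ}

/-- **The FIRST-ORDER increment MINUS ITS ONE-LINE TERM (`e^{Δ_C}G − G − Δ_C G`: at least two self-contractions) of the sectorised kernels across one slice,
binomial–Gram form, PRESCRIBED output legs, WEIGHTED output positions — the weighted ALL-KNOWN track** (BGM 2006 (2.61)–(2.63), (2.66), first order; §2.8 (2.82)–(2.84), (2.88)–(2.90), App. A3 Lemma A3.1; §3 (3.2)–(3.8)).  Data as in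
`sum_filter_wt_norm_sectorAnalysis_effAction_sub_gaussConv_le_graded_prescribed_of_plateau` (tree weight `wt`, position maps `π, π″`; thin/fat input families with the
plateau of `F` over `supp C` and `F′`; parents relation `child`, `≤ ρc` parents per fine label; ANY even input `G`; WEIGHTED coarse-family prescribed sizes `B m′ F` of `G`;
sectorised covariance replica-Gram-bounded, `κ ≥ 0`; WEIGHTED overlap costs `(cr, cc)`); output degree `2(q+1)`, leg `i ∉ J` pinned at `w″`, fine labels `τ″_j` prescribed
on `j ∈ J`.  Then `Σ_{X″_i = w″, (X″_j).2 = τ″_j} wt(π″X″)·‖kernel (map (toLin' E(F′)) (e^{Δ_C}G − G − Δ_C G)) (2q+2) X″‖ ≤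
cr·cc^{2q+1}·Σ_{m′ > q+2} (2q+2)!⁻¹(∏_{j∉J}(2m′−j))(2m′)^{|J|}κ^{2m′−2q−2}·(ρc^{|J|}·ε_x·B m′ |J|)`.
[cite: BenfattoGiulianiMastropietro2006, (2.61)-(2.63), (2.66), (2.88)-(2.90), App. A3 Lemma A3.1, (3.2)-(3.8)] -/
theorem sum_filter_wt_norm_sectorAnalysis_gaussConv_sub_sub_laplacian_le_binomial_prescribed_of_plateau
    (hwt : IsTreeWeight wt) (π : SpaceTimeIdx L M × SectorLeg N → Λ) (π'' : SpaceTimeIdx L M × SectorLeg N' → Λ)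
    {β : ℝ} (hβ : 0 < β) (F Ft : Fin N → FreqMomentum L M → ℂ) (hFF : ∀ ω k, Ft ω k * F ω k = F ω k)
    (hF0 : ∀ k, ∑ ω, F ω k = 0 → ∀ ω, F ω k = 0)
    (F' : Fin N' → FreqMomentum L M → ℂ) (G : HubbardGrassmann L M) (hG : G ∈ evenPart ℂ (HubbardFieldIdx L M))
    (C : Matrix (HubbardFieldIdx L M) (HubbardFieldIdx L M) ℂ)
    (hCpl : ∀ X Y, C X Y ≠ 0 → ∑ ω, F ω X.1.1 = 1 ∧ ∑ ω, F ω Y.1.1 = 1)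
    (hF'pl : ∀ (ω' : Fin N') (k : FreqMomentum L M), F' ω' k ≠ 0 → ∑ ω, F ω k = 1)
    (child : Fin N' → Fin N → Prop) [DecidableRel child]
    (hvan : ∀ (X'' : SpaceTimeIdx L M × SectorLeg N') (X' : SpaceTimeIdx L M × SectorLeg N),
      (sectorAnalysisMatrix L M β F' * sectorSubMatrix L M β Ft) X'' X' ≠ 0 →
        child X''.2.1.1 X'.2.1.1 ∧ X'.2.1.2 = X''.2.1.2 ∧ X'.2.2 = X''.2.2)
    {ρc : ℝ} (hρc0 : 0 ≤ ρc)
    (hρc : ∀ ℓ'' : SectorLeg N',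
      (((univ.filter fun ℓ' : SectorLeg N => child ℓ''.1.1 ℓ'.1.1 ∧ ℓ'.1.2 = ℓ''.1.2 ∧ ℓ'.2 = ℓ''.2).card : ℝ)) ≤ ρc)
    {κ : ℝ} (hκ : 0 ≤ κ)
    (hGB : IsGramBoundedR ((sectorSubMatrix L M β Ft).transpose * C * sectorSubMatrix L M β Ft) κ)
    (B : ℕ → ℕ → ℝ) (hB0 : ∀ m' Fc, 0 ≤ B m' Fc)
    (hB : ∀ (m' Fc : ℕ) (E : Finset (Fin (2 * m' + 1 + 1))) (τ : Fin (2 * m' + 1 + 1) → SectorLeg N) (q : Fin (2 * m' + 1 + 1)),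
      q ∈ E → E.card = Fc + 1 → ∀ y : SpaceTimeIdx L M,
        imagTimeWeight β M ^ (2 * m' + 1) *
          ∑ σ ∈ univ.filter (fun σ : Fin (2 * m' + 1 + 1) → SectorLeg N => ∀ e ∈ E, σ e = τ e),
            ∑ x ∈ univ.filter (fun x : Fin (2 * m' + 1 + 1) → SpaceTimeIdx L M => x q = y),
              wt ((univ.image fun i => (x i, σ i)).image π) * ‖sectorisedKernel L M β F G (2 * m' + 1 + 1) σ x‖ ≤ B (m' + 1) Fc)
    {cr cc : ℝ} (hcc0 : 0 ≤ cc)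
    (hrow' : ∀ X'', ∑ X', ‖(sectorAnalysisMatrix L M β F' * sectorSubMatrix L M β Ft) X'' X'‖ * wt {π'' X'', π X'} ≤ cr)
    (hcol' : ∀ X', ∑ X'', ‖(sectorAnalysisMatrix L M β F' * sectorSubMatrix L M β Ft) X'' X'‖ * wt {π'' X'', π X'} ≤ cc)
    {q : ℕ} (i : Fin (2 * q + 1 + 1)) (J : Finset (Fin (2 * q + 1 + 1))) (hi : i ∉ J) (τ'' : Fin (2 * q + 1 + 1) → SectorLeg N')
    (w'' : SpaceTimeIdx L M × SectorLeg N') :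
    ∑ X'' ∈ univ.filter (fun X'' : Fin (2 * q + 1 + 1) → SpaceTimeIdx L M × SectorLeg N' => X'' i = w'' ∧ ∀ j ∈ J, (X'' j).2 = τ'' j),
        wt ((univ.image X'').image π'') *
          ‖kernel ℂ (ExteriorAlgebra.map (Matrix.toLin' (sectorAnalysisMatrix L M β F')) (gaussConv ℂ C G - G - grassmannLaplacian ℂ C G))
            (2 * q + 1 + 1) X''‖ ≤
      cr * cc ^ (2 * q + 1) *
        ∑ m' ∈ range (Fintype.card (SpaceTimeIdx L M × SectorLeg N) / 2 + 1), (if q + 1 + 1 < m' then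
          ((((2 * (q + 1)).factorial : ℝ))⁻¹ * ((∏ j ∈ univ.filter (fun j : Fin (2 * (q + 1)) => j ∉ J), (2 * m' - (j : ℕ)) : ℕ) : ℝ)) *
            ((2 * m' : ℕ) : ℝ) ^ J.card * κ ^ (2 * m' - 2 * (q + 1)) * (ρc ^ J.card * (imagTimeWeight β M * B m' J.card)) else 0) := by
  classical
  have hε : 0 ≤ imagTimeWeight β M := imagTimeWeight_nonneg hβ.le M
  have hwl : ∀ S : Finset (SpaceTimeIdx L M × SectorLeg N), 0 ≤ wt (S.image π) := fun S => zero_le_one.trans (hwt.one_le _)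
  -- the parents of a fine label and the inherited predicates
  set Par : SectorLeg N' → Finset (SectorLeg N) :=
    fun ℓ'' => univ.filter fun ℓ' : SectorLeg N => child ℓ''.1.1 ℓ'.1.1 ∧ ℓ'.1.2 = ℓ''.1.2 ∧ ℓ'.2 = ℓ''.2 with hPar
  set A : Fin (2 * q + 1 + 1) → SpaceTimeIdx L M × SectorLeg N → Bool := fun j X' => decide (X'.2 ∈ Par (τ'' j)) with hA
  set Np : ℕ → ℕ → ℝ := fun m' Fc => ρc ^ Fc * (imagTimeWeight β M * B m' Fc) with hNp
  have hNp0 : ∀ m' Fc, 0 ≤ Np m' Fc := fun m' Fc => mul_nonneg (pow_nonneg hρc0 _) (mul_nonneg hε (hB0 _ _))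
  -- the input hypothesis for `Ṽ = sectorPreimage β F G` (§1)
  have hN : ∀ (m' : ℕ) (T : Finset (Fin (2 * q + 1 + 1))), T ⊆ J → ∀ (ι : T → Fin (2 * m')), Function.Injective ι →
      ∀ (t : Fin (2 * m')), (∀ j, ι j ≠ t) → ∀ a : SpaceTimeIdx L M × SectorLeg N,
        ∑ Y ∈ univ.filter (fun Y : Fin (2 * m') → SpaceTimeIdx L M × SectorLeg N => Y t = a),
          ‖kernel ℂ (sectorPreimage β F G) (2 * m') Y‖ * wt ((univ.image Y).image π) *
            ∏ j : T, (if A j (Y (ι j)) = true then (1 : ℝ) else 0) ≤ Np m' T.card := by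
    intro m' T _
    rcases m' with _ | m'
    · intro ι _ t
      exact Fin.elim0 (Fin.cast (Nat.mul_zero 2) t)
    · rw [show 2 * (m' + 1) = 2 * m' + 1 + 1 by ring]
      intro ι hι t ht a
      have h := sum_wt_norm_kernel_sectorPreimage_parentSlots_le_of_wt_prescribedSum_le hβ.le F G (fun S => wt (S.image π)) hwl m' B hB0
        (fun Fc E τ q' hq hE y => hB m' Fc E τ q' hq hE y) T (fun j : T => Par (τ'' j)) (fun j => hρc (τ'' j)) ι hι t ht a
      refine le_of_eq_of_le (sum_congr rfl fun Y _ => ?_) h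
      congr 1
      refine prod_congr rfl fun j _ => ?_
      simp only [hA, decide_eq_true_eq]
  -- the inherited predicates: a fine label only overlaps its parents
  have hPA : ∀ j ∈ J, ∀ (y'' : SpaceTimeIdx L M × SectorLeg N') (x' : SpaceTimeIdx L M × SectorLeg N),
      (fun (j : Fin (2 * q + 1 + 1)) (X'' : SpaceTimeIdx L M × SectorLeg N') => X''.2 = τ'' j) j y'' →
        (LinearMap.toMatrix' (Matrix.toLin' (sectorAnalysisMatrix L M β F')) *
            LinearMap.toMatrix' (Matrix.toLin' (sectorSubMatrix L M β Ft))) y'' x' ≠ 0 → A j x' = true := by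
    intro j _ y'' x' hPj hne
    rw [LinearMap.toMatrix'_toLin', LinearMap.toMatrix'_toLin'] at hne
    obtain ⟨h1, h2, h3⟩ := hvan y'' x' hne
    have hPj' : y''.2 = τ'' j := hPj
    simp only [hA, hPar, decide_eq_true_eq, mem_filter, mem_univ, true_and, ← hPj']
    exact ⟨h1, h2, h3⟩
  -- transfer: inside `E(F′)` replace `G` by `map S Ṽ`
  have hid := map_sectorAnalysis_map_sectorPreimage_of_plateau hβ.ne' F Ft hFF hF0 F' G hF'pl
  have hgc := map_sectorAnalysis_gaussConv_map_sectorPreimage_of_plateau hβ.ne' F Ft hFF hF0 F' G C hCpl hF'pl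
  have hgl := map_sectorAnalysis_grassmannLaplacian_map_sectorPreimage_of_plateau hβ.ne' F Ft hFF hF0 F' G C hCpl hF'pl
  have hrepl : ExteriorAlgebra.map (Matrix.toLin' (sectorAnalysisMatrix L M β F')) (gaussConv ℂ C G - G - grassmannLaplacian ℂ C G) =
      ExteriorAlgebra.map (Matrix.toLin' (sectorAnalysisMatrix L M β F'))
        (gaussConv ℂ C (ExteriorAlgebra.map (Matrix.toLin' (sectorSubMatrix L M β Ft)) (sectorPreimage β F G)) -
          ExteriorAlgebra.map (Matrix.toLin' (sectorSubMatrix L M β Ft)) (sectorPreimage β F G) -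
          grassmannLaplacian ℂ C (ExteriorAlgebra.map (Matrix.toLin' (sectorSubMatrix L M β Ft)) (sectorPreimage β F G))) := by
    rw [map_sub, map_sub, map_sub, map_sub, hid, hgc, hgl]
  rw [hrepl]
  exact sum_filter_wt_norm_kernel_map_gaussConv_sub_sub_laplacian_le_binomial_prescribed_of_gramBounded hwt π π'' C
    (Matrix.toLin' (sectorSubMatrix L M β Ft))
    (Matrix.toLin' (sectorAnalysisMatrix L M β F')) (sectorPreimage β F G) (sectorPreimage_mem_evenPart β F hG) hκ
    (by simpa only [LinearMap.toMatrix'_toLin'] using hGB) i J hi (fun j X'' => X''.2 = τ'' j) A hPA Np hNp0 hN hcc0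
    (by simpa only [LinearMap.toMatrix'_toLin'] using hrow') (by simpa only [LinearMap.toMatrix'_toLin'] using hcol') w''

end Transfer

end Literature.MathematicalPhysics.QuantumLattice

end
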